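import Literature.NumberTheory.Connes2026.AnnulusFamilySplit
import Literature.NumberTheory.Connes2026.AnnulusCorrectionLimit
import HarnessLib

/-!
# Connes 1999 Thm VII.4, `k = ℚ`, `S = {∞, p}` — THE `P = {p}` CASE REDUCED TO THE OFF-SHELL REMAINDER AND
# THE TRACE VALUE: (W0)–(W2) of `AnnulusCorrectionLimit` from the PROVED shell-localised part
# (`AnnulusFamilySplit`) plus three statements about `ϑ(g)(1 − Q₀) P̂⁰_M Q₀ ϑ_{m log p}` and one VALUE identity

LABEL (line 1): RH-FREE literature (theorems only; NO definition, NO named fact).  bears_on: LADDER-RH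
W-C/W-P (C1 named-fact debt), cell `rh-crit`, sub-cell cc, overflow row O1 — thirteenth file of the "annulus
road" under `Connes1999_thm_VII_4_rat`.  WHAT THIS IS NOT: any claim about positivity, Weil's criterion or RH.

Sources.  A. Connes, Selecta Math. 5 (1999) [`Connes1999`], §VII Thm 4 and proof (29)–(33) (held text
`paper:arxiv-math_9811068`, p0013); M. Reed, B. Simon (1972) [`ReedSimon1972`], Thm. VI.22, VI.24.

## What is proved

Notation: `Q₀ = annulusProj p 1 = shellProj p⁻¹ 1`, `ϑ_m = scalingUnitary (m log p)`, `K_m = Q₀ ∘ ϑ_m`,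
`Y_M(m) = P̂⁰_M Q₀ ϑ_m`, `f` a Hilbert basis of `L²(ℝ)_ev`, and the two halves of the diagonal coefficient
  `s_i = ⟨f_i, (ϑ(g) ∘ Q₀ ∘ Y_M(m)) f_i⟩` (shell part),  `o_i = ⟨f_i, (ϑ(g) ∘ (1 − Q₀) ∘ Y_M(m)) f_i⟩` (off-shell part).

* `diagCoeff_family_eq_shell_add_offShell` — `diagCoeff g (Y_M(m)) f_i = s_i + o_i`;
* `norm_family_le_one` — `‖Y_M(m)‖ ≤ 1`;
* **`Connes1999_thm_VII_4_rat_singleton_of_offShell`** — for a prime `p` and a Weil test function `g`, IF the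
  off-shell parts satisfy (O1) a uniform absolute bound `Σ_i |o_i| ≤ C'`, (O0) basis independence of `Σ_i o_i`,
  (O2) `Σ_i o_i → 0` as `M → ∞`, AND (V) the cutoff-free shell series has the VALUE
  `Σ_i ⟨f_i, (ϑ(g) ∘ Q₀ ∘ K_m) f_i⟩ = log p · g(−m log p)`, THEN the conclusion of `Connes1999_thm_VII_4_rat`
  holds at `P = {p}` — (W1), (W0), (W2) for the shell part being the theorems
  `exists_bound_tsum_norm_inner_scalingOp_shellProj`, `tsum_inner_scalingOp_shellProj_eq_of_hilbertBasis`,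
  `tendsto_tsum_inner_scalingOp_shellProj_dualCutoff` of `AnnulusFamilySplit`.

No instance, notation or attribute; no `def`.
-/

noncomputable section

open _root_.MeasureTheory Complex Set Filter
open scoped Real Topology ComplexConjugate ENNReal InnerProductSpace

namespace Literature.NumberTheory.Connes2026

open Literature.NumberTheory.LFunctions Literature.Analysis.OperatorTheory
open Literature.NumberTheory.ConnesConsani
open Literature.NumberTheory.ConnesConsani2024
open Literature.NumberTheory.ConnesConsani2021 hiding cutoffProj cutoffProj_coeFn

variable (p : ℕ) [hp : Fact p.Prime]

omit hp in
/-- **The diagonal coefficient of the family splits into shell and off-shell parts**: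
`⟨e, ϑ(g)(P̂⁰_M Q₀ ϑ_m e)⟩ = ⟨e, (ϑ(g)∘Q∘Y) e⟩ + ⟨e, (ϑ(g)∘(1−Q)∘Y) e⟩`, `Y = P̂⁰_M ∘ (Q₀ ∘ ϑ_m)`, any `Q`. [cite: Connes1999, §VII proof of Thm 4 eqs. (29)–(33) (arXiv p0013)] -/
theorem diagCoeff_family_eq_shell_add_offShell (g : ℝ → ℂ) (Q : Lp ℂ 2 (volume : Measure ℝ) →L[ℂ] Lp ℂ 2 (volume : Measure ℝ))
    (M : ℝ) (m : ℤ) (e : Lp ℂ 2 (volume : Measure ℝ)) :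
    diagCoeff g (dualCutoffProj ∅ M * annulusProj p 1 * scalingUnitary (m * Real.log p)) e =
      ⟪e, (scalingOp g ∘L (Q ∘L (dualCutoffProj ∅ M ∘L (annulusProj p 1 ∘L scalingUnitary (m * Real.log p))))) e⟫_ℂ +
      ⟪e, (scalingOp g ∘L ((1 - Q) ∘L (dualCutoffProj ∅ M ∘L (annulusProj p 1 ∘L scalingUnitary (m * Real.log p))))) e⟫_ℂ := by
  rw [diagCoeff, ← inner_add_right]
  congr 1
  simp only [ContinuousLinearMap.comp_apply, mul_apply_eq_comp, sub_apply, one_apply_eq_self, map_sub]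
  abel

omit hp in
/-- `‖P̂⁰_M Q₀ ϑ_m‖ ≤ 1`. [cite: Connes1999, §VII eqs. (12)–(13) (arXiv p0013)] -/
theorem norm_family_le_one (M : ℝ) (m : ℤ) :
    ‖dualCutoffProj ∅ M ∘L (annulusProj p 1 ∘L scalingUnitary (m * Real.log p))‖ ≤ 1 := by
  refine ContinuousLinearMap.opNorm_le_bound _ zero_le_one fun x => ?_
  rw [one_mul, ContinuousLinearMap.comp_apply, ContinuousLinearMap.comp_apply]
  refine (norm_dualCutoffProj_empty_le M _).trans ?_
  refine ((norm_annulusProj_le p 1) |> fun h => (ContinuousLinearMap.le_of_opNorm_le _ h _)).trans ?_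
  rw [one_mul, norm_scalingUnitary_apply]

/-- **The `P = {p}` case of `Connes1999_thm_VII_4_rat`, reduced to the off-shell remainder and the trace value.**
For a prime `p`, a Weil test function `g`, `Q₀ = Q_{1/p,1}`, `K_m = Q₀ ϑ_{m log p}`, `Y_M(m) = P̂⁰_M K_m`: assume
  (O1) `∃ C', ∀ M m f: Σ_i |⟨f_i, (ϑ(g)∘(1−Q₀)∘Y_M(m)) f_i⟩| ≤ C'` (absolutely summable),
  (O0) these off-shell series do not depend on the Hilbert basis `f` of `L²(ℝ)_ev`,
  (O2) they tend to `0` as `M → ∞`,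
  (V)  `Σ_i ⟨f_i, (ϑ(g)∘Q₀∘K_m) f_i⟩ = log p · g(−m log p)` for every `m` and `f`.
Then for every Hilbert basis `(e_i)` of `L²(ℝ)_ev`: the diagonal series of `ϑ(g) R_Λ^S` is summable for
`Λ > 0` and `Σ_i ⟨e_i, ϑ(g)R_Λ^S e_i⟩ − (2 log Λ · g(0) + connesLocalTerm p g + connesArchPV g) → 0`. [cite: Connes1999, §VII Thm 4 and proof eqs. (29)–(33) (arXiv p0013); Connes2026Letter, §7.4 (arXiv p0025:L16)] -/
theorem Connes1999_thm_VII_4_rat_singleton_of_offShell {g : ℝ → ℂ} (hg : IsWeilTest g) {C' : ℝ}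
    (hO1 : ∀ (M : ℝ) (m : ℤ) (ι : Type)
      (f : HilbertBasis ι ℂ (evenPart : Submodule ℂ (Lp ℂ 2 (volume : Measure ℝ)))),
      Summable (fun i => ‖⟪((f i : evenPart) : Lp ℂ 2 (volume : Measure ℝ)),
        (scalingOp g ∘L ((1 - shellProj (p : ℝ)⁻¹ 1) ∘L
          (dualCutoffProj ∅ M ∘L (annulusProj p 1 ∘L scalingUnitary (m * Real.log p)))))
          ((f i : evenPart) : Lp ℂ 2 (volume : Measure ℝ))⟫_ℂ‖) ∧
      ∑' i, ‖⟪((f i : evenPart) : Lp ℂ 2 (volume : Measure ℝ)),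
        (scalingOp g ∘L ((1 - shellProj (p : ℝ)⁻¹ 1) ∘L
          (dualCutoffProj ∅ M ∘L (annulusProj p 1 ∘L scalingUnitary (m * Real.log p)))))
          ((f i : evenPart) : Lp ℂ 2 (volume : Measure ℝ))⟫_ℂ‖ ≤ C')
    (hO0 : ∀ (M : ℝ) (m : ℤ) (ι : Type)
      (f : HilbertBasis ι ℂ (evenPart : Submodule ℂ (Lp ℂ 2 (volume : Measure ℝ)))) (ι' : Type)
      (f' : HilbertBasis ι' ℂ (evenPart : Submodule ℂ (Lp ℂ 2 (volume : Measure ℝ)))),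
      ∑' i, ⟪((f i : evenPart) : Lp ℂ 2 (volume : Measure ℝ)),
        (scalingOp g ∘L ((1 - shellProj (p : ℝ)⁻¹ 1) ∘L
          (dualCutoffProj ∅ M ∘L (annulusProj p 1 ∘L scalingUnitary (m * Real.log p)))))
          ((f i : evenPart) : Lp ℂ 2 (volume : Measure ℝ))⟫_ℂ =
      ∑' i, ⟪((f' i : evenPart) : Lp ℂ 2 (volume : Measure ℝ)),
        (scalingOp g ∘L ((1 - shellProj (p : ℝ)⁻¹ 1) ∘L
          (dualCutoffProj ∅ M ∘L (annulusProj p 1 ∘L scalingUnitary (m * Real.log p)))))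
          ((f' i : evenPart) : Lp ℂ 2 (volume : Measure ℝ))⟫_ℂ)
    (hO2 : ∀ (m : ℤ) (ι : Type) (f : HilbertBasis ι ℂ (evenPart : Submodule ℂ (Lp ℂ 2 (volume : Measure ℝ)))),
      Tendsto (fun M : ℝ => ∑' i, ⟪((f i : evenPart) : Lp ℂ 2 (volume : Measure ℝ)),
        (scalingOp g ∘L ((1 - shellProj (p : ℝ)⁻¹ 1) ∘L
          (dualCutoffProj ∅ M ∘L (annulusProj p 1 ∘L scalingUnitary (m * Real.log p)))))
          ((f i : evenPart) : Lp ℂ 2 (volume : Measure ℝ))⟫_ℂ) atTop (𝓝 0))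
    (hV : ∀ (m : ℤ) (ι : Type) (f : HilbertBasis ι ℂ (evenPart : Submodule ℂ (Lp ℂ 2 (volume : Measure ℝ)))),
      ∑' i, ⟪((f i : evenPart) : Lp ℂ 2 (volume : Measure ℝ)),
        (scalingOp g ∘L (shellProj (p : ℝ)⁻¹ 1 ∘L (annulusProj p 1 ∘L scalingUnitary (m * Real.log p))))
          ((f i : evenPart) : Lp ℂ 2 (volume : Measure ℝ))⟫_ℂ = (Real.log p : ℂ) * g (-(m * Real.log p)))
    (ι : Type) (b : HilbertBasis ι ℂ (evenPart : Submodule ℂ (Lp ℂ 2 (volume : Measure ℝ)))) :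
    (∀ Λ : ℝ, 0 < Λ →
      Summable fun i => diagCoeff g (cutoffR {p} Λ) ((b i : evenPart) : Lp ℂ 2 (volume : Measure ℝ))) ∧
    Tendsto (fun Λ : ℝ =>
        (∑' i, diagCoeff g (cutoffR {p} Λ) ((b i : evenPart) : Lp ℂ 2 (volume : Measure ℝ)))
          - connesSemilocalGeometricSide {p} Λ g)
      atTop (𝓝 0) := by
  have hp0 : (0 : ℝ) < p := by exact_mod_cast hp.out.pos
  have ha : (0 : ℝ) < (p : ℝ)⁻¹ := inv_pos.mpr hp0
  have hab : (p : ℝ)⁻¹ ≤ 1 := inv_le_one_of_one_le₀ (by exact_mod_cast hp.out.one_lt.le)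
  -- the shell part: (W1), (W0), (W2) from `AnnulusFamilySplit`
  obtain ⟨C, hC0, hS1⟩ := exists_bound_tsum_norm_inner_scalingOp_shellProj hg.1 hg.2 ha hab
  -- abbreviations for the three coefficient families
  set Y : ℝ → ℤ → (Lp ℂ 2 (volume : Measure ℝ) →L[ℂ] Lp ℂ 2 (volume : Measure ℝ)) :=
    fun M m => dualCutoffProj ∅ M ∘L (annulusProj p 1 ∘L scalingUnitary (m * Real.log p)) with hY
  have hYle : ∀ M m, ‖Y M m‖ ≤ 1 := fun M m => norm_family_le_one p M m
  have hsplit : ∀ (M : ℝ) (m : ℤ) (e : Lp ℂ 2 (volume : Measure ℝ)),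
      diagCoeff g (dualCutoffProj ∅ M * annulusProj p 1 * scalingUnitary (m * Real.log p)) e =
        ⟪e, (scalingOp g ∘L (shellProj (p : ℝ)⁻¹ 1 ∘L Y M m)) e⟫_ℂ +
        ⟪e, (scalingOp g ∘L ((1 - shellProj (p : ℝ)⁻¹ 1) ∘L Y M m)) e⟫_ℂ :=
    fun M m e => diagCoeff_family_eq_shell_add_offShell p g (shellProj (p : ℝ)⁻¹ 1) M m e
  -- (W1)
  have hW1 : ∀ (M : ℝ) (m : ℤ) (ι : Type)
      (f : HilbertBasis ι ℂ (evenPart : Submodule ℂ (Lp ℂ 2 (volume : Measure ℝ)))),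
      Summable (fun i => ‖diagCoeff g (dualCutoffProj ∅ M * annulusProj p 1 * scalingUnitary (m * Real.log p))
        ((f i : evenPart) : Lp ℂ 2 (volume : Measure ℝ))‖) ∧
      ∑' i, ‖diagCoeff g (dualCutoffProj ∅ M * annulusProj p 1 * scalingUnitary (m * Real.log p))
        ((f i : evenPart) : Lp ℂ 2 (volume : Measure ℝ))‖ ≤ C + C' := by
    intro M m ι' f
    obtain ⟨hs1, hs2⟩ := hS1 (Y M m) ι' f
    obtain ⟨ho1, ho2⟩ := hO1 M m ι' f
    simp_rw [hsplit]
    have hle := fun i => norm_add_le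
      ⟪((f i : evenPart) : Lp ℂ 2 (volume : Measure ℝ)), (scalingOp g ∘L (shellProj (p : ℝ)⁻¹ 1 ∘L Y M m))
        ((f i : evenPart) : Lp ℂ 2 (volume : Measure ℝ))⟫_ℂ
      ⟪((f i : evenPart) : Lp ℂ 2 (volume : Measure ℝ)), (scalingOp g ∘L ((1 - shellProj (p : ℝ)⁻¹ 1) ∘L Y M m))
        ((f i : evenPart) : Lp ℂ 2 (volume : Measure ℝ))⟫_ℂ
    refine ⟨Summable.of_nonneg_of_le (fun _ => norm_nonneg _) hle (hs1.add ho1), ?_⟩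
    refine ((Summable.of_nonneg_of_le (fun _ => norm_nonneg _) hle (hs1.add ho1)).tsum_le_tsum hle
      (hs1.add ho1)).trans ?_
    rw [hs1.tsum_add ho1]
    have h1 : C * ‖Y M m‖ ≤ C := by nlinarith [hYle M m, norm_nonneg (Y M m)]
    linarith
  -- (W0)
  have hW0 : ∀ (M : ℝ) (m : ℤ) (ι : Type)
      (f : HilbertBasis ι ℂ (evenPart : Submodule ℂ (Lp ℂ 2 (volume : Measure ℝ)))) (ι' : Type)
      (f' : HilbertBasis ι' ℂ (evenPart : Submodule ℂ (Lp ℂ 2 (volume : Measure ℝ)))),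
      ∑' i, diagCoeff g (dualCutoffProj ∅ M * annulusProj p 1 * scalingUnitary (m * Real.log p))
          ((f i : evenPart) : Lp ℂ 2 (volume : Measure ℝ)) =
        ∑' i, diagCoeff g (dualCutoffProj ∅ M * annulusProj p 1 * scalingUnitary (m * Real.log p))
          ((f' i : evenPart) : Lp ℂ 2 (volume : Measure ℝ)) := by
    intro M m ι' f ι'' f'
    simp_rw [hsplit]
    rw [(Summable.of_norm (hS1 (Y M m) ι' f).1).tsum_add (Summable.of_norm (hO1 M m ι' f).1),
      (Summable.of_norm (hS1 (Y M m) ι'' f').1).tsum_add (Summable.of_norm (hO1 M m ι'' f').1),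
      tsum_inner_scalingOp_shellProj_eq_of_hilbertBasis hg.1 hg.2 ha hab (Y M m) f f', hO0 M m ι' f ι'' f']
  -- (W2)
  have hW2 : ∀ (m : ℤ) (ι : Type)
      (f : HilbertBasis ι ℂ (evenPart : Submodule ℂ (Lp ℂ 2 (volume : Measure ℝ)))),
      Tendsto (fun M : ℝ => ∑' i,
          diagCoeff g (dualCutoffProj ∅ M * annulusProj p 1 * scalingUnitary (m * Real.log p))
            ((f i : evenPart) : Lp ℂ 2 (volume : Measure ℝ)))
        atTop (𝓝 ((Real.log p : ℂ) * g (-(m * Real.log p)))) := by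
    intro m ι' f
    have hfun : (fun M : ℝ => ∑' i,
          diagCoeff g (dualCutoffProj ∅ M * annulusProj p 1 * scalingUnitary (m * Real.log p))
            ((f i : evenPart) : Lp ℂ 2 (volume : Measure ℝ))) =
        fun M : ℝ => (∑' i, ⟪((f i : evenPart) : Lp ℂ 2 (volume : Measure ℝ)),
            (scalingOp g ∘L (shellProj (p : ℝ)⁻¹ 1 ∘L Y M m)) ((f i : evenPart) : Lp ℂ 2 (volume : Measure ℝ))⟫_ℂ) +
          ∑' i, ⟪((f i : evenPart) : Lp ℂ 2 (volume : Measure ℝ)),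
            (scalingOp g ∘L ((1 - shellProj (p : ℝ)⁻¹ 1) ∘L Y M m)) ((f i : evenPart) : Lp ℂ 2 (volume : Measure ℝ))⟫_ℂ := by
      funext M
      simp_rw [hsplit]
      exact (Summable.of_norm (hS1 (Y M m) ι' f).1).tsum_add (Summable.of_norm (hO1 M m ι' f).1)
    rw [hfun, ← hV m ι' f, ← add_zero (∑' i, ⟪((f i : evenPart) : Lp ℂ 2 (volume : Measure ℝ)),
      (scalingOp g ∘L (shellProj (p : ℝ)⁻¹ 1 ∘L (annulusProj p 1 ∘L scalingUnitary (m * Real.log p))))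
        ((f i : evenPart) : Lp ℂ 2 (volume : Measure ℝ))⟫_ℂ)]
    exact (tendsto_tsum_inner_scalingOp_shellProj_dualCutoff hg.1 hg.2 ha hab
      (annulusProj p 1 ∘L scalingUnitary (m * Real.log p)) f).add (hO2 m ι' f)
  exact Connes1999_thm_VII_4_rat_singleton_of_family p hg hW0 hW1 hW2 ι b

end Literature.NumberTheory.Connes2026
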